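import Literature.MathematicalPhysics.QuantumFieldTheory.Balaban1983to89.B4Eq212SupNeumann

/-!
# `Balaban1983to89.B4Eq222SupDecay` — [Balaban1983RegularityDecay] (2.12)–(2.13) ⇒ (2.22) p. 579 IN THE SUP NORM, ABSTRACT FORM:
# the EXPONENTIAL DECAY «|(G_k(Ω,A)f)(x)| ≤ c₀exp(−δ₀dist(x, supp f))‖f‖_∞» of Theorem (1.10) from the expansion
# `G_k(Ω,A) = G₀(I − R)⁻¹ = Σ_n G₀Rⁿ` (2.12) and the two per-cube inputs, for linear maps on `X → E` over ANY finite family of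
# «cubes» — the decay companion of `B4Eq212SupNeumann` (which proves the `n = 0` size `‖G‖_{∞→∞} ≤ 2m₀γ` only)

statement-level skeleton of published theorems with citation tags; proofs where landed; nothing here is a claim about the Yang–Mills mass gap

CITATION HEADER (lean-in-tree rule).  T. Bałaban, *Regularity and decay of lattice Green's functions*, Commun. Math. Phys. **89** (1983)
571–597, doi:10.1007/bf01214744 [Balaban1983RegularityDecay] (cell paper B4; held text `paper:balaban1983-cmp89-regularity-decay`, journal
page = PDF page + 570; pp. 573, 575–579 read by this seat).  Cell `lit-balaban` (HOME `run/shared/lean/pub/lit-balaban/`), Phase-2 proof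
seat **p35** gen 9 (unit `lit-balaban-p35`); SKELETON rows **B4.Eq2.12**, **B4.Eq2.13**, **B4.Eq2.18–2.22** (the decay sum (2.22) p. 579),
**B4.Thm@573** ((1.10) value member WITH ITS DECAY FACTOR) and — the consumer — **B1.Prop2.1**/(2.25) value clause with the factor
`exp(−δ₀(L^kε)⁻¹dist(x, supp f))` at a regular background `A ≠ 0` on the torus `Ω = T_ε` (this seat's `B1Ineq225DecayBackgroundTorus`).
USED BY NAME: gen 8's `B4Eq212SupNeumann.parametrix_identity` ((2.9)–(2.11)); nothing restated.  RELATION TO THE TREE: r01's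
`B4Ineq110WalkRoute.ineq110_value` proves the same decay for MATRICES over region carriers (labels in `ℤ^d`, positions in `ℝ^d`) by the
literal walk count of p. 579; this file is the geometry-free version for LINEAR MAPS on a Pi sup-normed space (the (Higgs)₂,₃ carriers
`Site P 0 → ℝ^N`), where the geometry enters only through a weight function — so that periodic labels (the torus) are covered.

WHAT IS PRINTED (p. 577, p. 579; OCR-checked against the held text).  p. 577: *«In the sequel we will see that R is a small operator in
reasonable norms because |∂^ηh_j| ≤ O(M⁻¹), |Δ^ηh_j| ≤ O(M⁻²), so we have the representations G_k(Ω, A) = G₀(I − R)⁻¹ = Σ_{n=0}^∞ G₀Rⁿ.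
(2.12) They can be written in a very convenient form of "random walk" representation … (2.13) … and this representation follows from (2.12)
and the obvious fact that h_jK_{j′} = 0 if |j − j′| = max_μ|j_μ − j′_μ| > 1.»*  p. 579: *«The summation in (2.18) is restricted to paths ω
satisfying x, x′ ∈ □_{ω₀}, supp f ⊂ □_{ω_n}, so the length n satisfies n ≥ M⁻¹dist({x, x′}, supp f) − 2. There are at most
2^d(3^d)^{n−1}2^d of such paths, so finally we get the inequality (the left hand side of (1.9)) ≤ Σ_{n ≥ M⁻¹dist({x,x′},supp f)−2}
2^dc₁(3^dc₂O(1)M⁻¹)ⁿ‖f‖_∞ ≤ 2^{d+1}c₁ … exp(−M⁻¹dist({x, x′}, supp f))‖f‖_∞, (2.22) … if M is fixed such that 3^dc₂O(1)M⁻¹ ≤ e⁻¹.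
Thus the inequality (1.9) is proved, similarly the inequalities (1.10).»*

WHAT THIS FILE PROVES (theorems only, kernel-checked; no `def`, no `sorry`; axioms standard).  Setting of `B4Eq212SupNeumann`: `X → E`
(`X` finite, `E` a real normed space, sup norm), `H` with left inverse `G`, cube operators `H_j` with right inverses `G_j`, real bumps `h_j`
(`Σ_j h_j² = 1`, `|h_j| ≤ 1`), the agreement (2.6), supports `S_j ⊇ supp h_j` carrying the rows of `K_j = [H_j, h_j]` with multiplicity
`≤ m₀`, and the per-cube inputs `‖G_j(h_jψ)‖ ≤ γ‖ψ‖` ((2.17)), `‖K_jG_j(h_jψ)‖ ≤ β‖ψ‖` ((2.20)).  NEW DATUM: a weight `w : X → ℝ` whose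
oscillation on every `S_j` is `≤ Λ`.
* §1 `norm_sum_le_of_rows` (row-multiplicity summation), `smul_weight_localize` / `norm_localize_le` (on `S_j` the weight `e^{w}` factors
  as `e^{w(x)}·e^{w − w(x)}` with `e^{w − w(x)} ≤ e^Λ`: ONE factor `e^Λ` per cube letter — the operator form of «h_jK_{j′} = 0 if
  |j − j′| > 1»: a letter moves at most one cube).
* §2 `norm_weighted_parametrix_le` (`‖e^{−w}G₀e^{w}‖ ≤ m₀γe^Λ`), `norm_weighted_remainder_le` (`‖e^{−w}Re^{w}‖ ≤ m₀βe^Λ`).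
* §3 **`norm_conj_apply_le`** — if `m₀βe^Λ ≤ ½` then `‖e^{−w}G(e^{w}ψ)‖_∞ ≤ 2m₀γe^Λ‖ψ‖_∞`: the series (2.12) conjugated by `e^{w}`
  converges in operator norm (bootstrapped on the finite operator norm, `dim E < ∞`).
* §4 **`norm_apply_le_of_weight`** (`‖(Gg)(x)‖ ≤ 2m₀γe^Λ·e^{w(x)}·sup_y e^{−w(y)}‖g(y)‖`) and **`norm_apply_le_of_dist`** — THE PRINTED
  SHAPE (2.22)/(1.10): for a pseudo-distance `dist` (zero on the diagonal, non-negative, triangle inequality) with `dist ≤ diam` on every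
  `S_j`, every `δ ≥ 0` with `m₀βe^{δ·diam} ≤ ½`, every `g` with `‖g‖ ≤ M` vanishing on `{y : dist(x, y) < D}`:
  `‖(Gg)(x)‖ ≤ 2m₀γe^{δ·diam}·e^{−δD}·M` (weight `w = δ·min(dist(x, ·), D)`); `norm_inverse_apply_le_of_dist` = the same for `G = Ring.inverse H`.
DECLARED DEVIATION FROM THE PRINTED ROUTE.  p. 579 bounds the walk expansion (2.13) TERM BY TERM (path length `n ≥ M⁻¹dist − 2`, at most
`2^d(3^d)^{n−1}2^d` paths, per-step factor `3^dc₂O(1)M⁻¹ ≤ e⁻¹`).  Here the same Neumann series (2.12) is bounded IN THE EXPONENTIALLY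
WEIGHTED SUP NORM instead (the Combes–Thomas form of the argument): conjugation by `e^{w}` costs a factor `e^{Λ}`, `Λ = δ·diam □`, per cube
letter, which is the operator-norm expression of «each step of the walk moves to an adjacent cube»; the inputs (γ, β, the multiplicity
`m₀ = 2^d` in place of the neighbour count `3^d`, the cube diameter `∝ M`) and the output (`δ₀ ∝ M⁻¹`, «δ₀, c₀ … depending on d, M only»,
p. 573) are those of the print.  The literal walk count is r01's `B4Ineq110WalkRoute` (region carriers).
HONEST SCOPE.  Value member only (no derivative/Hölder clause: those need the `D^η`-inputs of Lemma 2.2); the per-cube inputs, (2.6), the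
multiplicity and the diameter bound are HYPOTHESES (discharged on the torus by `B1Ineq225DecayBackgroundTorus`); `E` finite-dimensional from
§3 on.  Unit `lit-balaban-p35` gen 9 (literature-prover-lit-balaban-p35-g9-0).
-/

open scoped BigOperators

namespace Literature.MathematicalPhysics.QuantumFieldTheory.Balaban1983to89.B4Eq222SupDecay

open Literature.MathematicalPhysics.QuantumFieldTheory.Balaban1983to89.B4Eq212SupNeumann (parametrix_identity)

variable {X : Type*} [Fintype X] [DecidableEq X] {E : Type*} [NormedAddCommGroup E] [NormedSpace ℝ E]
variable {J : Type*} [Fintype J]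

/-! ## §1 Row-multiplicity summation and the localisation of the weight on a cube support -/

omit [NormedSpace ℝ E] in
/-- **Row-multiplicity summation**: if each field `T_j` vanishes off `S_j`, is bounded by `c` on `S_j`, and at most `m₀` of the `S_j`
meet a site, then `‖Σ_j T_j‖_∞ ≤ m₀c` (p. 576: at most `2^d` cubes see a point). [cite: Balaban1983RegularityDecay, (2.12)–(2.13) p.577] -/
theorem norm_sum_le_of_rows (S : J → Finset X) (m₀ : ℕ) (hmult : ∀ x, (Finset.univ.filter fun j => x ∈ S j).card ≤ m₀)
    (T : J → X → E) {c : ℝ} (hc : 0 ≤ c) (hzero : ∀ j x, x ∉ S j → T j x = 0) (hbd : ∀ j x, x ∈ S j → ‖T j x‖ ≤ c) :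
    ‖∑ j, T j‖ ≤ m₀ * c := by
  refine (pi_norm_le_iff_of_nonneg (by positivity)).2 fun x => ?_
  rw [Finset.sum_apply]
  have hvanish : ∀ j ∈ (Finset.univ : Finset J), j ∉ Finset.univ.filter (fun j => x ∈ S j) → T j x = 0 := by
    intro j _ hj
    exact hzero j x (by simpa using hj)
  rw [← Finset.sum_subset (Finset.filter_subset _ _) hvanish]
  calc ‖∑ j ∈ Finset.univ.filter (fun j => x ∈ S j), T j x‖
      ≤ ∑ j ∈ Finset.univ.filter (fun j => x ∈ S j), ‖T j x‖ := norm_sum_le _ _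
    _ ≤ ∑ j ∈ Finset.univ.filter (fun j => x ∈ S j), c :=
        Finset.sum_le_sum fun j hj => hbd j x (by simpa using hj)
    _ = ((Finset.univ.filter fun j => x ∈ S j).card : ℝ) * c := by rw [Finset.sum_const, nsmul_eq_mul]
    _ ≤ (m₀ : ℝ) * c := mul_le_mul_of_nonneg_right (by exact_mod_cast hmult x) hc

omit [Fintype X] [Fintype J] in
/-- **Localisation of the weight on `S_j`**: since `supp h_j ⊆ S_j`, `h_j·(e^{w}ψ) = e^{w(x)}·h_j·ψ_{j,x}` with
`ψ_{j,x} = 1_{S_j}e^{w − w(x)}ψ` — the conjugation by `e^{w}` seen from a site `x` of the same cube is a conjugation by the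
BOUNDED factor `e^{w − w(x)}` (p. 577: a cube letter moves at most one cube). [cite: Balaban1983RegularityDecay, (2.13) p.577] -/
theorem smul_weight_localize (h : J → X → ℝ) (S : J → Finset X) (hhS : ∀ j x, h j x ≠ 0 → x ∈ S j) (w : X → ℝ)
    (j : J) (x : X) (ψ : X → E) :
    (h j • fun y => Real.exp (w y) • ψ y)
      = Real.exp (w x) • (h j • fun y => if y ∈ S j then Real.exp (w y - w x) • ψ y else 0) := by
  funext y
  rw [Pi.smul_apply', Pi.smul_apply, Pi.smul_apply']
  by_cases hy : y ∈ S j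
  · rw [if_pos hy, smul_smul, smul_smul, smul_smul]
    congr 1
    have e : Real.exp (w y) = Real.exp (w x) * Real.exp (w y - w x) := by
      rw [← Real.exp_add]; congr 1; ring
    rw [e]; ring
  · have h0 : h j y = 0 := by
      by_contra hne
      exact hy (hhS j y hne)
    rw [h0, zero_smul, zero_smul, smul_zero]

omit [Fintype J] in
/-- **The localised field costs one factor `e^Λ`**: if the oscillation of `w` on `S_j` is `≤ Λ` and `x ∈ S_j`, then
`‖1_{S_j}e^{w − w(x)}ψ‖_∞ ≤ e^Λ‖ψ‖_∞`. [cite: Balaban1983RegularityDecay, (2.13) p.577; (2.22) p.579] -/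
theorem norm_localize_le (S : J → Finset X) (w : X → ℝ) {Λ : ℝ} (hw : ∀ j, ∀ y ∈ S j, ∀ y' ∈ S j, w y - w y' ≤ Λ)
    {j : J} {x : X} (hx : x ∈ S j) (ψ : X → E) :
    ‖(fun y => if y ∈ S j then Real.exp (w y - w x) • ψ y else 0 : X → E)‖ ≤ Real.exp Λ * ‖ψ‖ := by
  refine (pi_norm_le_iff_of_nonneg (by positivity)).2 fun y => ?_
  by_cases hy : y ∈ S j
  · simp only [if_pos hy]
    rw [norm_smul, Real.norm_eq_abs, abs_of_pos (Real.exp_pos _)]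
    exact mul_le_mul (Real.exp_le_exp.2 (hw j y hy x hx)) (norm_le_pi_norm ψ y) (norm_nonneg _) (Real.exp_pos _).le
  · simp only [if_neg hy, norm_zero]
    positivity

/-! ## §2 The weighted parametrix and remainder: `‖e^{−w}G₀e^{w}‖ ≤ m₀γe^Λ`, `‖e^{−w}Re^{w}‖ ≤ m₀βe^Λ` -/

/-- **`‖e^{−w}G₀(e^{w}ψ)‖_∞ ≤ m₀γe^Λ‖ψ‖_∞`** for `G₀ = Σ_j h_jG_jh_j` (2.2): at a site `x` only the `≤ m₀` cubes with `x ∈ S_j` contribute,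
and for those `e^{−w(x)}h_j(x)(G_j(h_je^{w}ψ))(x) = h_j(x)(G_j(h_jψ_{j,x}))(x)` with `‖G_j(h_jψ_{j,x})‖ ≤ γe^Λ‖ψ‖` ((2.17) at `p = q = ∞`).
[cite: Balaban1983RegularityDecay, (2.2) p.575; (2.12)–(2.13) p.577; (2.22) p.579] -/
theorem norm_weighted_parametrix_le (Gj : J → Module.End ℝ (X → E)) (h : J → X → ℝ) (habs : ∀ j x, |h j x| ≤ 1)
    (S : J → Finset X) (hhS : ∀ j x, h j x ≠ 0 → x ∈ S j)
    (m₀ : ℕ) (hmult : ∀ x, (Finset.univ.filter fun j => x ∈ S j).card ≤ m₀)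
    {γ : ℝ} (hγ : 0 ≤ γ) (hGj : ∀ j (ψ : X → E), ‖Gj j (h j • ψ)‖ ≤ γ * ‖ψ‖)
    (w : X → ℝ) {Λ : ℝ} (hw : ∀ j, ∀ y ∈ S j, ∀ y' ∈ S j, w y - w y' ≤ Λ) (ψ : X → E) :
    ‖(fun x => Real.exp (-w x) • (∑ j, h j • Gj j (h j • fun y => Real.exp (w y) • ψ y)) x : X → E)‖
      ≤ m₀ * (γ * Real.exp Λ * ‖ψ‖) := by
  have hfun : (fun x => Real.exp (-w x) • (∑ j, h j • Gj j (h j • fun y => Real.exp (w y) • ψ y)) x : X → E)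
      = ∑ j, (fun x => Real.exp (-w x) • (h j • Gj j (h j • fun y => Real.exp (w y) • ψ y)) x) := by
    funext x
    rw [Finset.sum_apply, Finset.sum_apply, Finset.smul_sum]
  rw [hfun]
  refine norm_sum_le_of_rows S m₀ hmult _ (by positivity) (fun j x hx => ?_) (fun j x hx => ?_)
  · have h0 : h j x = 0 := by
      by_contra hne
      exact hx (hhS j x hne)
    rw [Pi.smul_apply', h0, zero_smul, smul_zero]
  · have hloc := smul_weight_localize (E := E) h S hhS w j x ψ
    have hψloc := norm_localize_le S w hw hx ψ
    set ψloc : X → E := fun y => if y ∈ S j then Real.exp (w y - w x) • ψ y else 0 with hψloc_def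
    have hval : Real.exp (-w x) • (h j • Gj j (h j • fun y => Real.exp (w y) • ψ y)) x
        = h j x • Gj j (h j • ψloc) x := by
      rw [hloc, map_smul (Gj j) (Real.exp (w x)), Pi.smul_apply', Pi.smul_apply, smul_smul, smul_smul]
      congr 1
      rw [mul_comm (Real.exp (-w x)), mul_assoc, ← Real.exp_add, neg_add_cancel, Real.exp_zero, mul_one]
    rw [hval, norm_smul, Real.norm_eq_abs]
    calc |h j x| * ‖Gj j (h j • ψloc) x‖ ≤ 1 * (γ * (Real.exp Λ * ‖ψ‖)) := by
          refine mul_le_mul (habs j x) ?_ (norm_nonneg _) zero_le_one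
          exact (norm_le_pi_norm _ x).trans ((hGj j _).trans (mul_le_mul_of_nonneg_left hψloc hγ))
      _ = γ * Real.exp Λ * ‖ψ‖ := by ring

/-- **`‖e^{−w}Σ_jK_jG_j(h_je^{w}ψ)‖_∞ ≤ m₀βe^Λ‖ψ‖_∞`** for the remainder letters `K_j = [H_j, h_j]` (2.10)–(2.11): the rows of `K_j`
lie in `S_j`, and for `x ∈ S_j`, `e^{−w(x)}(K_jG_j(h_je^{w}ψ))(x) = (K_jG_j(h_jψ_{j,x}))(x)` with the factor bound (2.20) at `ψ_{j,x}`.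
[cite: Balaban1983RegularityDecay, (2.10)–(2.11) p.576; (2.20)–(2.22) pp.578–579] -/
theorem norm_weighted_remainder_le (Hj Gj : J → Module.End ℝ (X → E)) (h : J → X → ℝ)
    (S : J → Finset X) (hhS : ∀ j x, h j x ≠ 0 → x ∈ S j)
    (hKS : ∀ j (θ : X → E) x, x ∉ S j → (Hj j (h j • θ) - h j • Hj j θ) x = 0)
    (m₀ : ℕ) (hmult : ∀ x, (Finset.univ.filter fun j => x ∈ S j).card ≤ m₀)
    {β : ℝ} (hβ : 0 ≤ β)
    (hKj : ∀ j (ψ : X → E), ‖Hj j (h j • Gj j (h j • ψ)) - h j • Hj j (Gj j (h j • ψ))‖ ≤ β * ‖ψ‖)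
    (w : X → ℝ) {Λ : ℝ} (hw : ∀ j, ∀ y ∈ S j, ∀ y' ∈ S j, w y - w y' ≤ Λ) (ψ : X → E) :
    ‖(fun x => Real.exp (-w x) • (∑ j, (Hj j (h j • Gj j (h j • fun y => Real.exp (w y) • ψ y))
        - h j • Hj j (Gj j (h j • fun y => Real.exp (w y) • ψ y)))) x : X → E)‖
      ≤ m₀ * (β * Real.exp Λ * ‖ψ‖) := by
  have hfun : (fun x => Real.exp (-w x) • (∑ j, (Hj j (h j • Gj j (h j • fun y => Real.exp (w y) • ψ y))
        - h j • Hj j (Gj j (h j • fun y => Real.exp (w y) • ψ y)))) x : X → E)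
      = ∑ j, (fun x => Real.exp (-w x) • (Hj j (h j • Gj j (h j • fun y => Real.exp (w y) • ψ y))
        - h j • Hj j (Gj j (h j • fun y => Real.exp (w y) • ψ y))) x) := by
    funext x
    rw [Finset.sum_apply, Finset.sum_apply, Finset.smul_sum]
  rw [hfun]
  refine norm_sum_le_of_rows S m₀ hmult _ (by positivity) (fun j x hx => ?_) (fun j x hx => ?_)
  · rw [hKS j _ x hx, smul_zero]
  · have hloc := smul_weight_localize (E := E) h S hhS w j x ψ
    have hψloc := norm_localize_le S w hw hx ψ
    set ψloc : X → E := fun y => if y ∈ S j then Real.exp (w y - w x) • ψ y else 0 with hψloc_def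
    have hθ : Gj j (h j • fun y => Real.exp (w y) • ψ y) = Real.exp (w x) • Gj j (h j • ψloc) := by
      rw [hloc, map_smul (Gj j) (Real.exp (w x))]
    have hK : Hj j (h j • Gj j (h j • fun y => Real.exp (w y) • ψ y)) - h j • Hj j (Gj j (h j • fun y => Real.exp (w y) • ψ y))
        = Real.exp (w x) • (Hj j (h j • Gj j (h j • ψloc)) - h j • Hj j (Gj j (h j • ψloc))) := by
      rw [hθ, ← smul_comm (Real.exp (w x)) (h j), map_smul (Hj j) (Real.exp (w x)), map_smul (Hj j) (Real.exp (w x)),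
        ← smul_comm (Real.exp (w x)) (h j), ← smul_sub]
    rw [hK, Pi.smul_apply, smul_smul, ← Real.exp_add, neg_add_cancel, Real.exp_zero, one_smul]
    calc ‖(Hj j (h j • Gj j (h j • ψloc)) - h j • Hj j (Gj j (h j • ψloc))) x‖
        ≤ β * ‖ψloc‖ := (norm_le_pi_norm _ x).trans (hKj j ψloc)
      _ ≤ β * (Real.exp Λ * ‖ψ‖) := mul_le_mul_of_nonneg_left hψloc hβ
      _ = β * Real.exp Λ * ‖ψ‖ := by ring

/-! ## §3 (2.12) in the weighted sup norm: `‖e^{−w}G_k(Ω,A)e^{w}‖_{∞→∞} ≤ 2m₀γe^Λ` -/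

omit [Fintype X] [DecidableEq X] in
/-- `e^{w}·(e^{−w}·v) = v` pointwise. [folklore] -/
private theorem weight_unweight (w : X → ℝ) (v : X → E) :
    (fun y => Real.exp (w y) • (Real.exp (-w y) • v y)) = v := by
  funext y
  rw [smul_smul, ← Real.exp_add, add_neg_cancel, Real.exp_zero, one_smul]

/-- **(2.12) CONJUGATED BY `e^{w}`: `‖e^{−w}G(e^{w}ψ)‖_∞ ≤ 2m₀γe^Λ‖ψ‖_∞` whenever `m₀βe^Λ ≤ ½`.**  From (2.9)–(2.11) `HG₀ = 1 + Σ_jK_jG_jh_j`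
and `GH = 1`: `G = G₀ − G·(Σ_jK_jG_jh_j)`; conjugating, `G_w = (G₀)_w − G_w·R′_w` with `‖(G₀)_w‖ ≤ m₀γe^Λ` (§2) and `‖R′_w‖ ≤ m₀βe^Λ ≤ ½`,
so the (finite) operator norm of `G_w` obeys `‖G_w‖ ≤ m₀γe^Λ + ½‖G_w‖` — the series `Σ_n G₀Rⁿ` (2.12) summed in the weighted norm.
[cite: Balaban1983RegularityDecay, (2.12) p.577; (2.22) p.579] -/
theorem norm_conj_apply_le [FiniteDimensional ℝ E] (H G : Module.End ℝ (X → E)) (hGH : G * H = 1)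
    (Hj Gj : J → Module.End ℝ (X → E)) (hHG : ∀ j, Hj j * Gj j = 1)
    (h : J → X → ℝ) (hsum : ∀ x, ∑ j, h j x ^ 2 = 1) (habs : ∀ j x, |h j x| ≤ 1)
    (hagree : ∀ j (ψ : X → E), H (h j • ψ) = Hj j (h j • ψ))
    (S : J → Finset X) (hhS : ∀ j x, h j x ≠ 0 → x ∈ S j)
    (hKS : ∀ j (θ : X → E) x, x ∉ S j → (Hj j (h j • θ) - h j • Hj j θ) x = 0)
    (m₀ : ℕ) (hmult : ∀ x, (Finset.univ.filter fun j => x ∈ S j).card ≤ m₀)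
    {γ β : ℝ} (hγ : 0 ≤ γ) (hβ : 0 ≤ β)
    (hGj : ∀ j (ψ : X → E), ‖Gj j (h j • ψ)‖ ≤ γ * ‖ψ‖)
    (hKj : ∀ j (ψ : X → E), ‖Hj j (h j • Gj j (h j • ψ)) - h j • Hj j (Gj j (h j • ψ))‖ ≤ β * ‖ψ‖)
    (w : X → ℝ) {Λ : ℝ} (hw : ∀ j, ∀ y ∈ S j, ∀ y' ∈ S j, w y - w y' ≤ Λ)
    (hsmall : (m₀ : ℝ) * β * Real.exp Λ ≤ 1 / 2) (ψ : X → E) :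
    ‖(fun x => Real.exp (-w x) • G (fun y => Real.exp (w y) • ψ y) x : X → E)‖ ≤ 2 * m₀ * (γ * Real.exp Λ) * ‖ψ‖ := by
  -- the conjugated operator `G_w = e^{−w}Ge^{w}` as a continuous linear map (`e^{u}·` = `LinearMap.pi` of scaled projections)
  let Ew : (X → ℝ) → ((X → E) →ₗ[ℝ] (X → E)) := fun u =>
    LinearMap.pi fun x => Real.exp (u x) • (LinearMap.proj x : (X → E) →ₗ[ℝ] E)
  set Gw : (X → E) →L[ℝ] (X → E) := LinearMap.toContinuousLinearMap ((Ew (-w)).comp (G.comp (Ew w))) with hGw_def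
  have hGw : ∀ φ : X → E, (fun x => Real.exp (-w x) • G (fun y => Real.exp (w y) • φ y) x : X → E) = Gw φ :=
    fun φ => rfl
  -- `G_wφ = (G₀)_wφ − G_w(R′_wφ)` and the two bounds of §2
  have key : ∀ φ : X → E, ‖Gw φ‖ ≤ m₀ * (γ * Real.exp Λ * ‖φ‖) + ‖Gw‖ * (m₀ * (β * Real.exp Λ * ‖φ‖)) := by
    intro φ
    have eφ := (hGw φ).symm
    have hP := norm_weighted_parametrix_le Gj h habs S hhS m₀ hmult hγ hGj w hw φ
    have hR := norm_weighted_remainder_le Hj Gj h S hhS hKS m₀ hmult hβ hKj w hw φ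
    have hpar := parametrix_identity H Hj Gj hHG h hsum hagree (fun y => Real.exp (w y) • φ y)
    set Φ : X → E := fun y => Real.exp (w y) • φ y with hΦ
    have hG0 : G (H (∑ j, h j • Gj j (h j • Φ))) = ∑ j, h j • Gj j (h j • Φ) := by
      rw [← Module.End.mul_apply, hGH, Module.End.one_apply]
    rw [hpar, map_add] at hG0
    -- `GΦ = G₀Φ − G(R′Φ)`
    have hGΦ : G Φ = (∑ j, h j • Gj j (h j • Φ))
        - G (∑ j, (Hj j (h j • Gj j (h j • Φ)) - h j • Hj j (Gj j (h j • Φ)))) := by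
      rw [← hG0]; abel
    -- the remainder re-weighted: `G(R′Φ) = G(e^{w}ρ)` with `ρ = e^{−w}R′Φ`
    set ρ : X → E := fun x => Real.exp (-w x) • (∑ j, (Hj j (h j • Gj j (h j • Φ)) - h j • Hj j (Gj j (h j • Φ)))) x
      with hρ
    have hρw : (fun y => Real.exp (w y) • ρ y) = ∑ j, (Hj j (h j • Gj j (h j • Φ)) - h j • Hj j (Gj j (h j • Φ))) := by
      rw [hρ]; exact weight_unweight w _
    have eρ := (hGw ρ).symm
    rw [hρw] at eρ
    have hsplit : Gw φ = (fun x => Real.exp (-w x) • (∑ j, h j • Gj j (h j • Φ)) x) - Gw ρ := by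
      rw [eφ, eρ]
      funext x
      simp only [Pi.sub_apply]
      rw [hGΦ, Pi.sub_apply, smul_sub]
    rw [hsplit]
    refine (norm_sub_le _ _).trans (add_le_add hP ?_)
    exact (Gw.le_opNorm _).trans (mul_le_mul_of_nonneg_left hR (norm_nonneg _))
  -- `‖G_w‖ ≤ m₀γe^Λ + ‖G_w‖·m₀βe^Λ ≤ m₀γe^Λ + ½‖G_w‖`
  have hop : ‖Gw‖ ≤ m₀ * (γ * Real.exp Λ) + ‖Gw‖ * (m₀ * (β * Real.exp Λ)) := by
    refine ContinuousLinearMap.opNorm_le_bound Gw (by positivity) fun φ => ?_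
    calc ‖Gw φ‖ ≤ m₀ * (γ * Real.exp Λ * ‖φ‖) + ‖Gw‖ * (m₀ * (β * Real.exp Λ * ‖φ‖)) := key φ
      _ = (m₀ * (γ * Real.exp Λ) + ‖Gw‖ * (m₀ * (β * Real.exp Λ))) * ‖φ‖ := by ring
  have hhalf : ‖Gw‖ * (m₀ * (β * Real.exp Λ)) ≤ ‖Gw‖ * (1 / 2) :=
    mul_le_mul_of_nonneg_left (by rw [← mul_assoc]; exact hsmall) (norm_nonneg _)
  have hM : ‖Gw‖ ≤ 2 * m₀ * (γ * Real.exp Λ) := by linarith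
  calc ‖(fun x => Real.exp (-w x) • G (fun y => Real.exp (w y) • ψ y) x : X → E)‖ = ‖Gw ψ‖ := by rw [hGw]
    _ ≤ ‖Gw‖ * ‖ψ‖ := Gw.le_opNorm ψ
    _ ≤ 2 * m₀ * (γ * Real.exp Λ) * ‖ψ‖ := mul_le_mul_of_nonneg_right hM (norm_nonneg _)

/-! ## §4 The decay (2.22) / (1.10): `‖(Gg)(x)‖ ≤ c₀e^{−δ·dist(x, supp g)}‖g‖_∞` -/

/-- **WEIGHTED POINT BOUND**: under the hypotheses of `norm_conj_apply_le`, for every `g` and every site `x`,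
`‖(Gg)(x)‖ ≤ 2m₀γe^Λ·e^{w(x)}·B` whenever `e^{−w(y)}‖g(y)‖ ≤ B` for all `y` (write `g = e^{w}·(e^{−w}g)`).
[cite: Balaban1983RegularityDecay, (2.22) p.579; (2.12)–(2.13) p.577] -/
theorem norm_apply_le_of_weight [FiniteDimensional ℝ E] (H G : Module.End ℝ (X → E)) (hGH : G * H = 1)
    (Hj Gj : J → Module.End ℝ (X → E)) (hHG : ∀ j, Hj j * Gj j = 1)
    (h : J → X → ℝ) (hsum : ∀ x, ∑ j, h j x ^ 2 = 1) (habs : ∀ j x, |h j x| ≤ 1)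
    (hagree : ∀ j (ψ : X → E), H (h j • ψ) = Hj j (h j • ψ))
    (S : J → Finset X) (hhS : ∀ j x, h j x ≠ 0 → x ∈ S j)
    (hKS : ∀ j (θ : X → E) x, x ∉ S j → (Hj j (h j • θ) - h j • Hj j θ) x = 0)
    (m₀ : ℕ) (hmult : ∀ x, (Finset.univ.filter fun j => x ∈ S j).card ≤ m₀)
    {γ β : ℝ} (hγ : 0 ≤ γ) (hβ : 0 ≤ β)
    (hGj : ∀ j (ψ : X → E), ‖Gj j (h j • ψ)‖ ≤ γ * ‖ψ‖)
    (hKj : ∀ j (ψ : X → E), ‖Hj j (h j • Gj j (h j • ψ)) - h j • Hj j (Gj j (h j • ψ))‖ ≤ β * ‖ψ‖)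
    (w : X → ℝ) {Λ : ℝ} (hw : ∀ j, ∀ y ∈ S j, ∀ y' ∈ S j, w y - w y' ≤ Λ)
    (hsmall : (m₀ : ℝ) * β * Real.exp Λ ≤ 1 / 2)
    (g : X → E) {B : ℝ} (hB0 : 0 ≤ B) (hB : ∀ y, Real.exp (-w y) * ‖g y‖ ≤ B) (x : X) :
    ‖G g x‖ ≤ 2 * m₀ * (γ * Real.exp Λ) * (Real.exp (w x) * B) := by
  have hψB : ‖(fun y => Real.exp (-w y) • g y : X → E)‖ ≤ B := by
    refine (pi_norm_le_iff_of_nonneg hB0).2 fun y => ?_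
    rw [norm_smul, Real.norm_eq_abs, abs_of_pos (Real.exp_pos _)]
    exact hB y
  set ψ : X → E := fun y => Real.exp (-w y) • g y with hψ
  have hg : (fun y => Real.exp (w y) • ψ y) = g := by
    rw [hψ]; exact weight_unweight w g
  have h1 := norm_conj_apply_le H G hGH Hj Gj hHG h hsum habs hagree S hhS hKS m₀ hmult hγ hβ hGj hKj w hw hsmall ψ
  rw [hg] at h1
  have h2 : ‖Real.exp (-w x) • G g x‖ ≤ 2 * m₀ * (γ * Real.exp Λ) * B :=
    ((norm_le_pi_norm (fun x => Real.exp (-w x) • G g x : X → E) x).trans h1).trans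
      (mul_le_mul_of_nonneg_left hψB (by positivity))
  rw [norm_smul, Real.norm_eq_abs, abs_of_pos (Real.exp_pos _)] at h2
  have h3 : ‖G g x‖ = Real.exp (w x) * (Real.exp (-w x) * ‖G g x‖) := by
    rw [← mul_assoc, ← Real.exp_add, add_neg_cancel, Real.exp_zero, one_mul]
  rw [h3]
  calc Real.exp (w x) * (Real.exp (-w x) * ‖G g x‖) ≤ Real.exp (w x) * (2 * m₀ * (γ * Real.exp Λ) * B) :=
        mul_le_mul_of_nonneg_left h2 (Real.exp_pos _).le
    _ = 2 * m₀ * (γ * Real.exp Λ) * (Real.exp (w x) * B) := by ring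

omit [Fintype X] [DecidableEq X] [Fintype J] in
/-- The truncated distance weight `w = δ·min(dist(x, ·), D)` has oscillation `≤ δ·diam` on a set of `dist`-diameter `≤ diam`
(triangle inequality). [folklore] -/
private theorem weight_osc_le (dist : X → X → ℝ) (hdnn : ∀ x y, 0 ≤ dist x y) (htri : ∀ x y z, dist x z ≤ dist x y + dist y z)
    (S : J → Finset X) {diam : ℝ} (hdiam : ∀ j, ∀ y ∈ S j, ∀ y' ∈ S j, dist y y' ≤ diam) {δ : ℝ} (hδ : 0 ≤ δ) (x : X) (D : ℝ)
    (j : J) (y : X) (hy : y ∈ S j) (y' : X) (hy' : y' ∈ S j) :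
    δ * min (dist x y) D - δ * min (dist x y') D ≤ δ * diam := by
  rw [← mul_sub]
  refine mul_le_mul_of_nonneg_left ?_ hδ
  have h1 : min (dist x y) D ≤ min (dist x y') D + dist y' y := by
    calc min (dist x y) D ≤ min (dist x y' + dist y' y) D := min_le_min_right D (htri x y' y)
      _ ≤ min (dist x y' + dist y' y) (D + dist y' y) := min_le_min_left _ (le_add_of_nonneg_right (hdnn y' y))
      _ = min (dist x y') D + dist y' y := min_add_add_right _ _ _
  linarith [hdiam j y' hy' y hy]

/-- **THEOREM (1.10), VALUE MEMBER WITH ITS DECAY FACTOR — ABSTRACT (2.22) IN THE SUP NORM.**  In the setting of `B4Eq212SupNeumann` let `dist`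
be a pseudo-distance on the sites (zero on the diagonal, non-negative, triangle inequality) with `dist ≤ diam` on every cube support `S_j`,
and let `δ ≥ 0` satisfy `m₀βe^{δ·diam} ≤ ½` (the choice of `M` on p. 579: «3^dc₂O(1)M⁻¹ ≤ e⁻¹»).  Then for every `g` with `‖g‖_∞ ≤ M`
vanishing on `{y : dist(x, y) < D}` (`D ≥ 0`): `‖(Gg)(x)‖ ≤ 2m₀γe^{δ·diam}·e^{−δD}·M` — «|(G_k(Ω,A)f)(x)| ≤ c₀exp(−δ₀dist(x, supp f))‖f‖_∞»
with `c₀ = 2m₀γe^{δ·diam}`, `δ₀ = δ ∝ (diam □)⁻¹ ∝ M⁻¹`. [cite: Balaban1983RegularityDecay, Theorem (1.10) p.573; (2.22) p.579; (2.12)–(2.13) p.577] -/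
theorem norm_apply_le_of_dist [FiniteDimensional ℝ E] (H G : Module.End ℝ (X → E)) (hGH : G * H = 1)
    (Hj Gj : J → Module.End ℝ (X → E)) (hHG : ∀ j, Hj j * Gj j = 1)
    (h : J → X → ℝ) (hsum : ∀ x, ∑ j, h j x ^ 2 = 1) (habs : ∀ j x, |h j x| ≤ 1)
    (hagree : ∀ j (ψ : X → E), H (h j • ψ) = Hj j (h j • ψ))
    (S : J → Finset X) (hhS : ∀ j x, h j x ≠ 0 → x ∈ S j)
    (hKS : ∀ j (θ : X → E) x, x ∉ S j → (Hj j (h j • θ) - h j • Hj j θ) x = 0)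
    (m₀ : ℕ) (hmult : ∀ x, (Finset.univ.filter fun j => x ∈ S j).card ≤ m₀)
    {γ β : ℝ} (hγ : 0 ≤ γ) (hβ : 0 ≤ β)
    (hGj : ∀ j (ψ : X → E), ‖Gj j (h j • ψ)‖ ≤ γ * ‖ψ‖)
    (hKj : ∀ j (ψ : X → E), ‖Hj j (h j • Gj j (h j • ψ)) - h j • Hj j (Gj j (h j • ψ))‖ ≤ β * ‖ψ‖)
    (dist : X → X → ℝ) (hd0 : ∀ x, dist x x = 0) (hdnn : ∀ x y, 0 ≤ dist x y) (htri : ∀ x y z, dist x z ≤ dist x y + dist y z)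
    {diam : ℝ} (hdiam : ∀ j, ∀ y ∈ S j, ∀ y' ∈ S j, dist y y' ≤ diam)
    {δ : ℝ} (hδ : 0 ≤ δ) (hsmall : (m₀ : ℝ) * β * Real.exp (δ * diam) ≤ 1 / 2)
    (g : X → E) {M : ℝ} (hgM : ∀ y, ‖g y‖ ≤ M) {D : ℝ} (hD0 : 0 ≤ D) (x : X) (hD : ∀ y, g y ≠ 0 → D ≤ dist x y) :
    ‖G g x‖ ≤ 2 * m₀ * (γ * Real.exp (δ * diam)) * Real.exp (-(δ * D)) * M := by
  have hM0 : 0 ≤ M := (norm_nonneg _).trans (hgM x)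
  -- the weight `w = δ·min(dist(x, ·), D)`: `w(x) = 0`, `w = δD` on `supp g`, oscillation `≤ δ·diam` on each `S_j`
  set w : X → ℝ := fun y => δ * min (dist x y) D with hw_def
  have hwx : w x = 0 := by
    simp only [hw_def, hd0, min_eq_left hD0, mul_zero]
  have hB : ∀ y, Real.exp (-w y) * ‖g y‖ ≤ Real.exp (-(δ * D)) * M := by
    intro y
    by_cases hy : g y = 0
    · rw [hy, norm_zero, mul_zero]; exact mul_nonneg (Real.exp_pos _).le hM0
    · have hwy : w y = δ * D := by
        simp only [hw_def, min_eq_right (hD y hy)]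
      rw [hwy]
      exact mul_le_mul_of_nonneg_left (hgM y) (Real.exp_pos _).le
  have h := norm_apply_le_of_weight H G hGH Hj Gj hHG h hsum habs hagree S hhS hKS m₀ hmult hγ hβ hGj hKj w
    (fun j y hy y' hy' => weight_osc_le dist hdnn htri S hdiam hδ x D j y hy y' hy') hsmall g
    (mul_nonneg (Real.exp_pos _).le hM0) hB x
  rw [hwx, Real.exp_zero, one_mul] at h
  linarith

/-- **(1.10)/(2.22) for `G = H⁻¹` given as `Ring.inverse H`** (the shape of the Higgs-model propagator `HiggsCovariance.propagatorK =
Ring.inverse (covOpK …)`): when `H` is a unit, `‖(H⁻¹g)(x)‖ ≤ 2m₀γe^{δ·diam}e^{−δD}M` under the hypotheses of `norm_apply_le_of_dist`.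
[cite: Balaban1983RegularityDecay, Theorem (1.10) p.573; (2.22) p.579] -/
theorem norm_inverse_apply_le_of_dist [FiniteDimensional ℝ E] (H : Module.End ℝ (X → E)) (hH : IsUnit H)
    (Hj Gj : J → Module.End ℝ (X → E)) (hHG : ∀ j, Hj j * Gj j = 1)
    (h : J → X → ℝ) (hsum : ∀ x, ∑ j, h j x ^ 2 = 1) (habs : ∀ j x, |h j x| ≤ 1)
    (hagree : ∀ j (ψ : X → E), H (h j • ψ) = Hj j (h j • ψ))
    (S : J → Finset X) (hhS : ∀ j x, h j x ≠ 0 → x ∈ S j)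
    (hKS : ∀ j (θ : X → E) x, x ∉ S j → (Hj j (h j • θ) - h j • Hj j θ) x = 0)
    (m₀ : ℕ) (hmult : ∀ x, (Finset.univ.filter fun j => x ∈ S j).card ≤ m₀)
    {γ β : ℝ} (hγ : 0 ≤ γ) (hβ : 0 ≤ β)
    (hGj : ∀ j (ψ : X → E), ‖Gj j (h j • ψ)‖ ≤ γ * ‖ψ‖)
    (hKj : ∀ j (ψ : X → E), ‖Hj j (h j • Gj j (h j • ψ)) - h j • Hj j (Gj j (h j • ψ))‖ ≤ β * ‖ψ‖)
    (dist : X → X → ℝ) (hd0 : ∀ x, dist x x = 0) (hdnn : ∀ x y, 0 ≤ dist x y) (htri : ∀ x y z, dist x z ≤ dist x y + dist y z)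
    {diam : ℝ} (hdiam : ∀ j, ∀ y ∈ S j, ∀ y' ∈ S j, dist y y' ≤ diam)
    {δ : ℝ} (hδ : 0 ≤ δ) (hsmall : (m₀ : ℝ) * β * Real.exp (δ * diam) ≤ 1 / 2)
    (g : X → E) {M : ℝ} (hgM : ∀ y, ‖g y‖ ≤ M) {D : ℝ} (hD0 : 0 ≤ D) (x : X) (hD : ∀ y, g y ≠ 0 → D ≤ dist x y) :
    ‖Ring.inverse H g x‖ ≤ 2 * m₀ * (γ * Real.exp (δ * diam)) * Real.exp (-(δ * D)) * M :=
  norm_apply_le_of_dist H (Ring.inverse H) (Ring.inverse_mul_cancel H hH) Hj Gj hHG h hsum habs hagree S hhS hKS m₀ hmult hγ hβ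
    hGj hKj dist hd0 hdnn htri hdiam hδ hsmall g hgM hD0 x hD

end Literature.MathematicalPhysics.QuantumFieldTheory.Balaban1983to89.B4Eq222SupDecay
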